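import Mathlib
import Literature.MathematicalPhysics.QuantumLattice.WilsonFermionBlockAveraging

/-!
# Small-hopping diamagnetism (stmt-QuantumFields-9738, route QuarksAsStableAction): definitions

Proof-side objects for the hopping-parameter expansion of the Wilson–Dirac determinant
(`Summit.QuantumFields.QCD.Theses.QuarksAsStableAction.SmallHoppingDiamagnetism`).  No statement of
the route is restated here; these are the bookkeeping devices of the proof:

* `Letter = Fin 4 × Bool`: an oriented lattice direction (`(μ, true)` = `+μ̂`, `(μ, false)` =
  `-μ̂`); `Letter.inv`, the unit step `stepVec`, the displacement `disp w` of a word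
  `w : List Letter`, balanced words `balanced w = true` (every letter occurs as often as its
  inverse — the words closed in `ℤ⁴`), the plaquette offset `gpOffset a b` of a letter swap;
* for a gauge field `V` on the four-torus: the link variable `link V x l` picked up by a hop from
  `x` along `l` (`V(x,μ)` forward, `V(x-μ̂,μ)⁻¹` backward) and the ordered holonomy `hol V x w`
  of a word;
* the Wilson spin factors `spinMat l = 1 ∓ γ_μ` (`r = 1`) and their ordered products `spinWord w`;
* the hopping matrices `hopLetter ρ V l` (the tree's `wilsonHopFwd` / `wilsonHopBwd` at `r = 1`),
  their sum `hopMatrix ρ V = Σ_l hopLetter ρ V l` (so `D_W = (m+4)·1 - ½ hopMatrix`, by the tree's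
  `wilsonDirac_eq`), and the word matrices `wordMat ρ V w = Π_{l ∈ w} hopLetter ρ V l`;
* deficits: `defect ρ g = N - Re tr ρ(g)`, the word deficit `wordDefect ρ V w = Σ_x defect (hol)`
  and the plane action `planeDefect ρ V μ ν = Σ_x defect (U_{μν}(x))`;
* the `ℓ²` structure on quark fields `Fld L N = (site × colour × spin → ℂ)`: `ip`, `nsq`, colour
  transports `ctransport` and spin action `spin` (for the bound `‖H v‖ ≤ 8 ‖v‖`);
* `apLift U`: the `U(3)` lift of an `SU(3)` configuration with the antiperiodic seam sign flips of
  the statement (links leaving the slice `x_μ = -1` negated).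

All proofs live in the sibling files `QuarksAsStableActionSmallHoppingDiamagnetism*.lean`.
-/

noncomputable section

namespace Summit.QuantumFields.QCD.Theorems.SmallHopping

open Literature.Probability.LatticeModels Literature.MathematicalPhysics.QuantumLattice
  Literature.MathematicalPhysics.QuantumFieldTheory Matrix
open scoped ComplexConjugate

/-! ## Letters, steps, words -/

/-- An oriented lattice direction: `(μ, true)` is the forward step `+μ̂`, `(μ, false)` the backward
step `-μ̂`. -/
abbrev Letter : Type := Fin 4 × Bool

/-- The inverse (reversed) letter. -/
def Letter.inv (l : Letter) : Letter := (l.1, !l.2)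

variable {L : ℕ}

/-- The unit step of a letter as a vector of the torus `(ℤ/L)⁴`: `± e_μ`. -/
def stepVec (l : Letter) : TorusSite 4 L :=
  if l.2 then Pi.single l.1 1 else -Pi.single l.1 1

/-- The total displacement of a word (sum of its unit steps) on the torus of side `L`. -/
def disp (w : List Letter) : TorusSite 4 L := (w.map stepVec).sum

/-- A word is balanced when every letter occurs exactly as often as its inverse, i.e. the word is
closed as a path in `ℤ⁴` (not merely on the torus).  (`Bool`-valued, so that finite case analyses
run by `decide`.) -/
def balanced (w : List Letter) : Bool := decide (∀ l : Letter, w.count l = w.count l.inv)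

/-- The offset of the honest plaquette equivalent to the generalised plaquette
`[a, b, a⁻¹, b⁻¹]` of two letters: `-[a backward] e_{a} - [b backward] e_{b}` (see `genPlaquette_conj`
in the sibling `…Stokes` file). -/
def gpOffset (a b : Letter) : TorusSite 4 L :=
  (if a.2 then 0 else -Pi.single a.1 1) + (if b.2 then 0 else -Pi.single b.1 1)

/-! ## Link variables and word holonomies -/

section Holonomy

variable {G : Type*} [Group G]

/-- The group element picked up by a hop from `x` along the letter `l`: `V(x,μ)` for the forward
step `+μ̂` and `V(x-μ̂,μ)⁻¹` for the backward step `-μ̂`. -/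
def link (V : GaugeConfig 4 L G) (x : TorusSite 4 L) (l : Letter) : G :=
  if l.2 then V (x, l.1) else (V (x - Pi.single l.1 1, l.1))⁻¹

/-- The ordered holonomy of the word `w` read as a lattice path starting at `x`:
`hol V x (l :: w) = link V x l * hol V (x + step l) w`, `hol V x [] = 1`. -/
def hol (V : GaugeConfig 4 L G) : TorusSite 4 L → List Letter → G
  | _, [] => 1
  | x, l :: w => link V x l * hol V (x + stepVec l) w

end Holonomy

/-! ## Spin factors -/

/-- The Wilson spin factor of a letter at `r = 1`: `1 - γ_μ` for `+μ̂`, `1 + γ_μ` for `-μ̂`. -/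
def spinMat (l : Letter) : Matrix (Fin 4) (Fin 4) ℂ :=
  if l.2 then 1 - euclideanGamma l.1 else 1 + euclideanGamma l.1

/-- The ordered product of the spin factors of a word. -/
def spinWord (w : List Letter) : Matrix (Fin 4) (Fin 4) ℂ := (w.map spinMat).prod

/-! ## Hopping matrices and word matrices -/

section Hopping

variable {N : ℕ} {G : Type*} [Group G] (ρ : G →* Matrix (Fin N) (Fin N) ℂ)

/-- The hopping matrix of a letter: the tree's forward / backward Wilson hopping matrices
`wilsonHopFwd ρ V 1 μ` / `wilsonHopBwd ρ V 1 μ` (`r = 1`). -/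
def hopLetter (V : GaugeConfig 4 L G) (l : Letter) :
    Matrix (TorusSite 4 L × Fin N × Fin 4) (TorusSite 4 L × Fin N × Fin 4) ℂ :=
  if l.2 then wilsonHopFwd ρ V 1 l.1 else wilsonHopBwd ρ V 1 l.1

/-- The full hopping matrix `H = Σ_l hopLetter l = Σ_μ (H⁺_μ + H⁻_μ)`, so that the Wilson–Dirac
operator at `r = 1` is `D_W = (m + 4)·1 - ½ H = (m + 4)(1 - κ H)`, `κ = 1/(2m + 8)`. -/
def hopMatrix (V : GaugeConfig 4 L G) :
    Matrix (TorusSite 4 L × Fin N × Fin 4) (TorusSite 4 L × Fin N × Fin 4) ℂ :=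
  ∑ l : Letter, hopLetter ρ V l

/-- The word matrix: the ordered product of the hopping matrices of the letters of `w`
(so `H ^ k` is the sum of the word matrices of all words of length `k`). -/
def wordMat [NeZero L] (V : GaugeConfig 4 L G) (w : List Letter) :
    Matrix (TorusSite 4 L × Fin N × Fin 4) (TorusSite 4 L × Fin N × Fin 4) ℂ :=
  (w.map (hopLetter ρ V)).prod

/-! ## Deficits -/

/-- The deficit `N - Re tr ρ(g)` of a group element (nonnegative for unitary `ρ`, zero at `1`). -/
def defect (g : G) : ℝ := N - (ρ g).trace.re

/-- The word deficit: the deficits of the holonomies of `w` summed over all base points. -/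
def wordDefect [NeZero L] (V : GaugeConfig 4 L G) (w : List Letter) : ℝ :=
  ∑ x : TorusSite 4 L, defect ρ (hol V x w)

/-- The plane action: the plaquette deficits in the `(μ, ν)` plane summed over all base points. -/
def planeDefect [NeZero L] (V : GaugeConfig 4 L G) (μ ν : Fin 4) : ℝ :=
  ∑ x : TorusSite 4 L, defect ρ (plaquetteHolonomy V x μ ν)

end Hopping

/-! ## Quark fields and their `ℓ²` structure -/

/-- Quark fields on the four-torus of side `L` with `N` colours: site × colour × spin components. -/
abbrev Fld (L N : ℕ) : Type := TorusSite 4 L × Fin N × Fin 4 → ℂ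

section Fields

variable {N : ℕ}

/-- The `ℓ²` inner product `⟨u, w⟩ = Σ_i conj(u i) w i` (conjugate-linear in the first slot). -/
def ip [NeZero L] (u w : Fld L N) : ℂ := ∑ i, conj (u i) * w i

/-- The squared `ℓ²` norm `Σ_i ‖u i‖²`. -/
def nsq [NeZero L] (u : Fld L N) : ℝ := ∑ i, ‖u i‖ ^ 2

/-- The colour transport by the matrix field `A` with site offset `e`:
`(ctransport A e u)(x,a,α) = Σ_b A(x)_{ab} u(x+e,b,α)`. -/
def ctransport (A : TorusSite 4 L → Matrix (Fin N) (Fin N) ℂ) (e : TorusSite 4 L) (u : Fld L N) :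
    Fld L N :=
  fun p => ∑ b, A p.1 p.2.1 b * u (p.1 + e, b, p.2.2)

/-- The action of a `4 × 4` matrix on the spin index: `(spin Γ u)(x,a,α) = Σ_β Γ_{αβ} u(x,a,β)`. -/
def spin (Γ : Matrix (Fin 4) (Fin 4) ℂ) (u : Fld L N) : Fld L N :=
  fun p => ∑ β, Γ p.2.2 β * u (p.1, p.2.1, β)

end Fields

/-! ## The antiperiodic `U(3)` lift of the statement -/

/-- The `U(3)`-valued configuration of the statement `SmallHoppingDiamagnetism`: the `SU(3)` links
of `U` viewed in `U(3)`, with the links leaving the slice `x_μ = -1` in direction `μ` negated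
(antiperiodic quark boundary conditions in all four directions). -/
def apLift (U : GaugeConfig 4 L (Matrix.specialUnitaryGroup (Fin 3) ℂ)) :
    GaugeConfig 4 L (Matrix.unitaryGroup (Fin 3) ℂ) :=
  fun e => if e.1 e.2 = -1 then
    -(⟨(U e).1, Matrix.specialUnitaryGroup_le_unitaryGroup (U e).2⟩ : Matrix.unitaryGroup (Fin 3) ℂ)
    else ⟨(U e).1, Matrix.specialUnitaryGroup_le_unitaryGroup (U e).2⟩

end Summit.QuantumFields.QCD.Theorems.SmallHopping
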